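import Mathlib
import HarnessLib
import Summits.KontsevichZagierPeriods.KontsevichZagierPeriods.Theses.LinRedNormalForm

/-!
# Line `torus-descent-sum-shadow` — skeleton for crux `DihedralNormalForm` (stmt-KontsevichZagierPeriods-3912)

Lead prover's skeleton of line `torus-descent-sum-shadow` (planner
`planner-cruxplan-stmt-KontsevichZagierPeriods-391-torus-descent-sum-sh-0`, registered skeleton sha
`546cfff7a19a`), REBUILT by the lead from the six registered stub signatures (the planner's file
`Lines/torus-descent-sum-shadow.lean` was never published under `Cruxes/DihedralNormalForm/Lines/`
and the gate evidence store is not mounted in the lead's jail). Six stubs, verbatim; composition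
sorry-free.

## Objects (cubical chart `tᵢ = x₀ x₁ ⋯ xᵢ` of the open ordered simplex)

* `Atom k` — cubical ATOM representations `[□ᵏ, q · xᵃ · ∏_{i ≤ j} (1 − x_i ⋯ x_j)^{e i j}]`,
  `a ∈ ℕᵏ`, `e ∈ ℤ` (chords = intervals `[i, j]` of coordinates), absolutely convergent (they are
  `KZ.IntegralRep`s). `AtomLT k` / `AtomLE k`: atoms of dimension `< k` / `≤ k`.
* a DESCENT DIRECTION of an atom is a cocharacter `lam ∈ {0, ±1}ᵏ` with some `lam p = −1`,
  orthogonal to every active chord (`e i j ≠ 0 ⇒ Σ_{l ∈ [i,j]} lam l = 0`) and of non-zero total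
  weight `E = Σ lam l · (a l + 1)`; it is SIMPLE if moreover every active chord contains at most
  one `+1`. `DAtom k` / `SDAtom k`: atoms admitting a (simple) descent direction.
* `WAtom k` — WORD ATOMS: the MZV word representations read in the cubical chart,
  `q · ∏ xᵢ^{k−1−i} · ∏ ω_{εᵢ}(x₀⋯xᵢ)`.
* `WordRep` — the crux's target generators (MZV word representations on the simplex).

## The chain

`stub_atomReduction : crux input ↦ closure (Atom k)` ·
`stub_torusDescent : SD-atom of dim k+1 ↦ Σ_p [□ᵏ, base_p]` (ONE Newton–Leibniz move per entry
face along the straightened torus orbit, monomial primitive) ·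
`stub_rebase : Σ_p [□ᵏ, base_p] ↦ closure (AtomLE k)` ·
`stub_nonSimpleReduction : D-atom, not SD ↦ closure (SDAtom k ∪ WAtom k ∪ AtomLT k)` ·
`stub_balancedRewriting : balanced atom ↦ closure (WAtom k ∪ DAtom k ∪ AtomLT k)` (HARDEST, lead) ·
`stub_wordAtomChart : WAtom k ↦ closure WordRep`.
Composition: strong induction on the dimension `k`; inside one dimension the three stages
balanced → directed → simply directed → lower dimension are well-founded by construction.
-/

noncomputable section

set_option linter.dupNamespace false

open MeasureTheory Set

namespace Summit.KontsevichZagierPeriods.KontsevichZagierPeriods.Cruxes.DihedralNormalForm.TorusDescent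

open Literature.NumberTheory.Transcendental

/-! ## The generator sets -/

/-- The crux's target generators: MZV word representations `[Δ_w, q · ∏ ω_{εᵢ}(tᵢ)]`. -/
abbrev WordRep : Set KZ.FormalRep :=
  {x : Literature.NumberTheory.Transcendental.KZ.FormalRep | ∃ (w : ℕ) (ε : Fin w → Bool) (q : ℚ) (s : Literature.NumberTheory.Transcendental.KZ.IntegralRep w), s.domain = {t | (∀ i, 0 < t i) ∧ (∀ i, t i < 1) ∧ StrictAnti t} ∧ Set.EqOn s.integrand (fun t => (q : ℝ) * ∏ i, if ε i then 1 / (1 - t i) else 1 / t i) s.domain ∧ x = Literature.NumberTheory.Transcendental.KZ.of s}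

/-- Cubical atoms of dimension `k` (module docstring). -/
abbrev Atom (k : ℕ) : Set KZ.FormalRep :=
  {z : Literature.NumberTheory.Transcendental.KZ.FormalRep | ∃ (q : ℚ) (a : Fin k → ℕ) (e : Fin k → Fin k → ℤ) (s : Literature.NumberTheory.Transcendental.KZ.IntegralRep k), s.domain = {x : Fin k → ℝ | ∀ i, x i ∈ Set.Ioo (0:ℝ) 1} ∧ Set.EqOn s.integrand (fun x => (q : ℝ) * ((∏ i : Fin k, x i ^ a i) * ∏ i : Fin k, ∏ j : Fin k, if i ≤ j then (1 - (∏ l : Fin k, if i ≤ l ∧ l ≤ j then x l else 1)) ^ e i j else 1)) s.domain ∧ z = Literature.NumberTheory.Transcendental.KZ.of s}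

/-- Atoms of dimension `< k`. -/
abbrev AtomLT (k : ℕ) : Set KZ.FormalRep :=
  {z : Literature.NumberTheory.Transcendental.KZ.FormalRep | ∃ d : ℕ, d < k ∧ z ∈ Atom d}

/-- Atoms of dimension `≤ k`. -/
abbrev AtomLE (k : ℕ) : Set KZ.FormalRep :=
  {z : Literature.NumberTheory.Transcendental.KZ.FormalRep | ∃ d : ℕ, d ≤ k ∧ z ∈ Atom d}

/-- Atoms with a descent direction. -/
abbrev DAtom (k : ℕ) : Set KZ.FormalRep :=
  {z : Literature.NumberTheory.Transcendental.KZ.FormalRep | ∃ (q : ℚ) (a : Fin k → ℕ) (e : Fin k → Fin k → ℤ) (s : Literature.NumberTheory.Transcendental.KZ.IntegralRep k), (∃ lam : Fin k → ℤ, (∀ l : Fin k, lam l = 0 ∨ lam l = 1 ∨ lam l = -1) ∧ (∃ p : Fin k, lam p = -1) ∧ (∀ i j : Fin k, i ≤ j → e i j ≠ 0 → (∑ l : Fin k, if i ≤ l ∧ l ≤ j then lam l else 0) = 0) ∧ (∑ l : Fin k, lam l * ((a l : ℤ) + 1)) ≠ 0) ∧ s.domain = {x : Fin k → ℝ | ∀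 i, x i ∈ Set.Ioo (0:ℝ) 1} ∧ Set.EqOn s.integrand (fun x => (q : ℝ) * ((∏ i : Fin k, x i ^ a i) * ∏ i : Fin k, ∏ j : Fin k, if i ≤ j then (1 - (∏ l : Fin k, if i ≤ l ∧ l ≤ j then x l else 1)) ^ e i j else 1)) s.domain ∧ z = Literature.NumberTheory.Transcendental.KZ.of s}

/-- Atoms with a SIMPLE descent direction. -/
abbrev SDAtom (k : ℕ) : Set KZ.FormalRep :=
  {z : Literature.NumberTheory.Transcendental.KZ.FormalRep | ∃ (q : ℚ) (a : Fin k → ℕ) (e : Fin k → Fin k → ℤ) (s : Literature.NumberTheory.Transcendental.KZ.IntegralRep k), (∃ lam : Fin k → ℤ, (∀ l : Fin k, lam l = 0 ∨ lam l = 1 ∨ lam l = -1) ∧ (∃ p : Fin k, lam p = -1) ∧ (∀ i j : Fin k, i ≤ j → e i j ≠ 0 → (∑ l : Fin k, if i ≤ l ∧ l ≤ j then lam l else 0) = 0 ∧ (Finset.univ.filter (fun l : Fin k => i ≤ l ∧ l ≤ j ∧ lam l = 1)).card ≤ 1) ∧ (∑ l : Fin k, lam l * ((a l : ℤ) + 1))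 ≠ 0) ∧ s.domain = {x : Fin k → ℝ | ∀ i, x i ∈ Set.Ioo (0:ℝ) 1} ∧ Set.EqOn s.integrand (fun x => (q : ℝ) * ((∏ i : Fin k, x i ^ a i) * ∏ i : Fin k, ∏ j : Fin k, if i ≤ j then (1 - (∏ l : Fin k, if i ≤ l ∧ l ≤ j then x l else 1)) ^ e i j else 1)) s.domain ∧ z = Literature.NumberTheory.Transcendental.KZ.of s}

/-- Word atoms: MZV word representations read in the cubical chart `tᵢ = x₀⋯xᵢ`. -/
abbrev WAtom (k : ℕ) : Set KZ.FormalRep :=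
  {z : Literature.NumberTheory.Transcendental.KZ.FormalRep | ∃ (q : ℚ) (ε : Fin k → Bool) (s : Literature.NumberTheory.Transcendental.KZ.IntegralRep k), s.domain = {x : Fin k → ℝ | ∀ i, x i ∈ Set.Ioo (0:ℝ) 1} ∧ Set.EqOn s.integrand (fun x => (q : ℝ) * ((∏ i : Fin k, x i ^ (k - 1 - (i : ℕ))) * ∏ i : Fin k, if ε i then 1 / (1 - (∏ l : Fin k, if l ≤ i then x l else 1)) else 1 / (∏ l : Fin k, if l ≤ i then x l else 1))) s.domain ∧ z = Literature.NumberTheory.Transcendental.KZ.of s}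

/-! ## The six registered stubs (signatures verbatim) -/

/-- **stub_atomReduction** (L). ENTRANCE: the cubical chart `tᵢ = x₀ x₁ ⋯ xᵢ` (rule 2, polynomial map, Jacobian `∏ xᵢ^{k-1-i}`) carries a genus-zero representation on the open ordered simplex to the open cube, where the integrand is `P(x)·x^{-B}·∏(1 - x_I)^{e_I}`; Brown's lemma (ENS 2009, Lemma 7.4: absolute convergence forces the dihedral-coordinate expansion to be polynomial) splits it into a `ℚ`-combination of CONVERGENT atoms (rule 1b, every term convergent). -/
theorem stub_atomReduction : ∀ (k : ℕ) (r : Literature.NumberTheory.Transcendental.KZ.IntegralRep k) (p : MvPolynomial (Fin k) ℚ) (a : Fin k → Fin k → ℕ) (b c : Fin k → ℕ), r.domain = {t | (∀ i, 0 < t i) ∧ (∀ i, t i < 1) ∧ StrictAnti t} → Set.EqOn r.integrand (fun t => MvPolynomial.aeval t p / ((∏ i, t i ^ b i) * (∏ i, (1 - t i) ^ c i) * ∏ i, ∏ j, if i < j then (t i - t j) ^ a i j else 1)) r.domain → ∃ m ∈ AddSubgroup.closure {z : Literature.NumberTheory.Transcendental.KZ.FormalRep | ∃ (q : ℚ) (a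 : Fin k → ℕ) (e : Fin k → Fin k → ℤ) (s : Literature.NumberTheory.Transcendental.KZ.IntegralRep k), s.domain = {x : Fin k → ℝ | ∀ i, x i ∈ Set.Ioo (0:ℝ) 1} ∧ Set.EqOn s.integrand (fun x => (q : ℝ) * ((∏ i : Fin k, x i ^ a i) * ∏ i : Fin k, ∏ j : Fin k, if i ≤ j then (1 - (∏ l : Fin k, if i ≤ l ∧ l ≤ j then x l else 1)) ^ e i j else 1)) s.domain ∧ z = Literature.NumberTheory.Transcendental.KZ.of s}, Literature.NumberTheory.Transcendental.KZ.of r - m ∈ Literature.NumberTheory.Transcendental.KZ.relations := by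
  sorry

/-- **stub_torusDescent** (L). THE MOVE: for a simple descent direction `lam` of an atom `g` of dimension `k+1`, dissect the cube by the entry face of the torus orbit `t ↦ (t^{lam l} x_l)` (rule 1a: pieces `{x_p = max_{lam = -1} x}`), straighten each piece by the monomial map `y_l = x_l · x_p^{lam l}` (`l ≠ p`), `s = x_p` (rule 2) onto the band `{(y, s) : max_{lam = +1} y ≤ s ≤ 1}` resp. `{0 ≤ s ≤ 1}`, where the integrand is `q · g(y, x_p = 1) · s^{-E-1}`, and integrate `s` out by ONE Newton–Leibniz move with the monomial primitive `-(q/E) g · s^{-E}` (rule 3); the base over the entry face `p` is `[□ᵏ, (q/E) · g|_{x_p = 1}(y) · ((max_{lam = +1} y)^{-E} - 1)]`, absolutely convergent by the fibrewise triangle equality (the integrand has constant sign). -/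
theorem stub_torusDescent : ∀ (k : ℕ) (q : ℚ) (a : Fin (k + 1) → ℕ) (e : Fin (k + 1) → Fin (k + 1) → ℤ) (lam : Fin (k + 1) → ℤ) (s : Literature.NumberTheory.Transcendental.KZ.IntegralRep (k + 1)), s.domain = {x : Fin (k + 1) → ℝ | ∀ i, x i ∈ Set.Ioo (0:ℝ) 1} → Set.EqOn s.integrand (fun x => (q : ℝ) * ((∏ i : Fin (k + 1), x i ^ a i) * ∏ i : Fin (k + 1), ∏ j : Fin (k + 1), if i ≤ j then (1 - (∏ l : Fin (k + 1), if i ≤ l ∧ l ≤ j then x l else 1)) ^ e i j else 1)) s.domain → (∀ l : Fin (k + 1), lam l = 0 ∨ lam l = 1 ∨ lam l = -1) → (∃ p : Fin (k + 1), lam p = -1) → (∀ i j : Fin (k + 1), i ≤ j → e i j ≠ 0 → (∑ l : Fin (k + 1), if i ≤ l ∧ l ≤ j then lam l else 0) = 0 ∧ (Finset.univ.filter (fun l : Fin (k + 1) => i ≤ l ∧ l ≤ j ∧ lam l = 1)).card ≤ 1) → (∑ l : Fin (k + 1), lam l * ((a l : ℤ) + 1)) ≠ 0 → ∃ B : Fin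 (k + 1) → Literature.NumberTheory.Transcendental.KZ.IntegralRep k, (∀ p : Fin (k + 1), lam p = -1 → (B p).domain = {y : Fin k → ℝ | ∀ i, y i ∈ Set.Ioo (0:ℝ) 1} ∧ Set.EqOn (B p).integrand (fun y => ((q / (((∑ l : Fin (k + 1), lam l * ((a l : ℤ) + 1)) : ℤ) : ℚ) : ℚ) : ℝ) * ((∏ i : Fin (k + 1), (Fin.insertNth p (1:ℝ) y) i ^ a i) * ∏ i : Fin (k + 1), ∏ j : Fin (k + 1), if i ≤ j then (1 - (∏ l : Fin (k + 1), if i ≤ l ∧ l ≤ j then (Fin.insertNth p (1:ℝ) y) l else 1)) ^ e i j else 1) * ((⨆ j : Fin k, if lam (Fin.succAbove p j) = 1 then y j else (0:ℝ)) ^ (-(∑ l : Fin (k + 1), lam l * ((a l : ℤ) + 1))) - 1)) (B p).domain) ∧ Literature.NumberTheory.Transcendental.KZ.of s - (∑ p : Fin (k + 1), if lam p = -1 then Literature.NumberTheory.Transcendental.KZ.of (B p) else 0) ∈ Literature.NumberTheory.Transcendental.KZ.relations := by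
  sorry

/-- **stub_rebase** (M–L). The bases of `stub_torusDescent` are `ℤ`-combinations of atoms of dimension `≤ k` modulo relations: `g|_{x_p=1}` is an atom in the remaining coordinates (chords through `p` shrink, `e p p = 0` is forced by `lam p = -1`); with `P = {lam = +1}`: if `P = ∅` the factor is `-1`; otherwise dissect by `{y_j = max_P y}` (rule 1a), expand `y_j^{-E} - 1 = (1 - y_j)·Σ_{m<E} y_j^{m-E}` (`E > 0`) resp. `-(1 - y_j^{|E|})` (`E < 0`) into SAME-SIGN terms (rule 1b, termwise convergent by positivity), and fold the cone `{y_j ≥ y_{j'}, j' ∈ P}` onto the cube by `y_{j'} = y_j w_{j'}` (rule 2, monomial); exponents stay `≥ 0` because `E ≤ Σ_P (a + 1) - 1`. -/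
theorem stub_rebase : ∀ (k : ℕ) (q : ℚ) (a : Fin (k + 1) → ℕ) (e : Fin (k + 1) → Fin (k + 1) → ℤ) (lam : Fin (k + 1) → ℤ) (B : Fin (k + 1) → Literature.NumberTheory.Transcendental.KZ.IntegralRep k), (∀ l : Fin (k + 1), lam l = 0 ∨ lam l = 1 ∨ lam l = -1) → (∃ p : Fin (k + 1), lam p = -1) → (∀ i j : Fin (k + 1), i ≤ j → e i j ≠ 0 → (∑ l : Fin (k + 1), if i ≤ l ∧ l ≤ j then lam l else 0) = 0 ∧ (Finset.univ.filter (fun l : Fin (k + 1) => i ≤ l ∧ l ≤ j ∧ lam l = 1)).card ≤ 1) → (∑ l : Fin (k + 1), lam l * ((a l : ℤ) + 1)) ≠ 0 → (∀ p : Fin (k + 1), lam p = -1 → (B p).domain = {y : Fin k → ℝ | ∀ i, y i ∈ Set.Ioo (0:ℝ) 1} ∧ Set.EqOn (B p).integrand (fun y => (q : ℝ) * ((∏ i : Fin (k + 1), (Fin.insertNth p (1:ℝ) y) i ^ a i) * ∏ i : Fin (k + 1), ∏ j : Fin (k + 1), if i ≤ j then (1 - (∏ l : Fin (k + 1), if i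 ≤ l ∧ l ≤ j then (Fin.insertNth p (1:ℝ) y) l else 1)) ^ e i j else 1) * ((⨆ j : Fin k, if lam (Fin.succAbove p j) = 1 then y j else (0:ℝ)) ^ (-(∑ l : Fin (k + 1), lam l * ((a l : ℤ) + 1))) - 1)) (B p).domain) → ∃ m ∈ AddSubgroup.closure {z : Literature.NumberTheory.Transcendental.KZ.FormalRep | ∃ d : ℕ, d ≤ k ∧ z ∈ {z : Literature.NumberTheory.Transcendental.KZ.FormalRep | ∃ (q : ℚ) (a : Fin d → ℕ) (e : Fin d → Fin d → ℤ) (s : Literature.NumberTheory.Transcendental.KZ.IntegralRep d), s.domain = {x : Fin d → ℝ | ∀ i, x i ∈ Set.Ioo (0:ℝ) 1} ∧ Set.EqOn s.integrand (fun x => (q : ℝ) * ((∏ i : Fin d, x i ^ a i) * ∏ i : Fin d, ∏ j : Fin d, if i ≤ j then (1 - (∏ l : Fin d, if i ≤ l ∧ l ≤ j then x l else 1)) ^ e i j else 1)) s.domain ∧ z = Literature.NumberTheory.Transcendental.KZ.of s}}, (∑ p : Fin (k + 1), if lam p = -1 then Literature.NumberTheory.Transcendental.KZ.of (B p) else 0)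 - m ∈ Literature.NumberTheory.Transcendental.KZ.relations := by
  sorry

/-- **stub_nonSimpleReduction** (L). An atom with a descent direction but no SIMPLE one is congruent to a combination of simply-directed atoms, word atoms and lower-dimensional atoms (uncross the offending `+1` pairs inside a chord: dissect `x_p ≶ x_q` (rule 1a) and fold (rule 2, monomial), Ptolemy / kernel splits (rule 1b between convergent atoms)). -/
theorem stub_nonSimpleReduction : ∀ (k : ℕ) (q : ℚ) (a : Fin k → ℕ) (e : Fin k → Fin k → ℤ) (s : Literature.NumberTheory.Transcendental.KZ.IntegralRep k), s.domain = {x : Fin k → ℝ | ∀ i, x i ∈ Set.Ioo (0:ℝ) 1} → Set.EqOn s.integrand (fun x => (q : ℝ) * ((∏ i : Fin k, x i ^ a i) * ∏ i : Fin k, ∏ j : Fin k, if i ≤ j then (1 - (∏ l : Fin k, if i ≤ l ∧ l ≤ j then x l else 1)) ^ e i j else 1)) s.domain → ¬ (∃ lam : Fin k → ℤ, (∀ l : Fin k, lam l = 0 ∨ lam l = 1 ∨ lam l = -1) ∧ (∃ p : Fin k, lam p = -1) ∧ (∀ i j : Fin k, i ≤ j → e i j ≠ 0 → (∑ l : Fin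 k, if i ≤ l ∧ l ≤ j then lam l else 0) = 0 ∧ (Finset.univ.filter (fun l : Fin k => i ≤ l ∧ l ≤ j ∧ lam l = 1)).card ≤ 1) ∧ (∑ l : Fin k, lam l * ((a l : ℤ) + 1)) ≠ 0) → (∃ lam : Fin k → ℤ, (∀ l : Fin k, lam l = 0 ∨ lam l = 1 ∨ lam l = -1) ∧ (∃ p : Fin k, lam p = -1) ∧ (∀ i j : Fin k, i ≤ j → e i j ≠ 0 → (∑ l : Fin k, if i ≤ l ∧ l ≤ j then lam l else 0) = 0) ∧ (∑ l : Fin k, lam l * ((a l : ℤ) + 1)) ≠ 0) → ∃ m ∈ AddSubgroup.closure ({z : Literature.NumberTheory.Transcendental.KZ.FormalRep | ∃ (q : ℚ) (a : Fin k → ℕ) (e : Fin k → Fin k → ℤ) (s : Literature.NumberTheory.Transcendental.KZ.IntegralRep k), (∃ lam : Fin k → ℤ, (∀ l : Fin k, lam l = 0 ∨ lam l = 1 ∨ lam l = -1) ∧ (∃ p : Fin k, lam p = -1) ∧ (∀ i j : Fin k, i ≤ j → e i j ≠ 0 → (∑ l : Fin k, if i ≤ l ∧ l ≤ j then lam l else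 0) = 0 ∧ (Finset.univ.filter (fun l : Fin k => i ≤ l ∧ l ≤ j ∧ lam l = 1)).card ≤ 1) ∧ (∑ l : Fin k, lam l * ((a l : ℤ) + 1)) ≠ 0) ∧ s.domain = {x : Fin k → ℝ | ∀ i, x i ∈ Set.Ioo (0:ℝ) 1} ∧ Set.EqOn s.integrand (fun x => (q : ℝ) * ((∏ i : Fin k, x i ^ a i) * ∏ i : Fin k, ∏ j : Fin k, if i ≤ j then (1 - (∏ l : Fin k, if i ≤ l ∧ l ≤ j then x l else 1)) ^ e i j else 1)) s.domain ∧ z = Literature.NumberTheory.Transcendental.KZ.of s} ∪ {z : Literature.NumberTheory.Transcendental.KZ.FormalRep | ∃ (q : ℚ) (ε : Fin k → Bool) (s : Literature.NumberTheory.Transcendental.KZ.IntegralRep k), s.domain = {x : Fin k → ℝ | ∀ i, x i ∈ Set.Ioo (0:ℝ) 1} ∧ Set.EqOn s.integrand (fun x => (q : ℝ) * ((∏ i : Fin k, x i ^ (k - 1 - (i : ℕ))) * ∏ i : Fin k, if ε i then 1 / (1 - (∏ l : Fin k, if l ≤ i then x l else 1)) else 1 / (∏ l : Fin k, if l ≤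 i then x l else 1))) s.domain ∧ z = Literature.NumberTheory.Transcendental.KZ.of s} ∪ {z : Literature.NumberTheory.Transcendental.KZ.FormalRep | ∃ d : ℕ, d < k ∧ z ∈ {z : Literature.NumberTheory.Transcendental.KZ.FormalRep | ∃ (q : ℚ) (a : Fin d → ℕ) (e : Fin d → Fin d → ℤ) (s : Literature.NumberTheory.Transcendental.KZ.IntegralRep d), s.domain = {x : Fin d → ℝ | ∀ i, x i ∈ Set.Ioo (0:ℝ) 1} ∧ Set.EqOn s.integrand (fun x => (q : ℝ) * ((∏ i : Fin d, x i ^ a i) * ∏ i : Fin d, ∏ j : Fin d, if i ≤ j then (1 - (∏ l : Fin d, if i ≤ l ∧ l ≤ j then x l else 1)) ^ e i j else 1)) s.domain ∧ z = Literature.NumberTheory.Transcendental.KZ.of s}}), Literature.NumberTheory.Transcendental.KZ.of s - m ∈ Literature.NumberTheory.Transcendental.KZ.relations := by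
  sorry

/-- **stub_balancedRewriting** (XL, HARDEST — held by the lead). A BALANCED atom (no descent direction) is congruent to a combination of word atoms, directed atoms and lower-dimensional atoms: the rewriting system {Ptolemy/shift/kernel splits (1b), boundary-free Euler identities (3 with zero base + 1b), uncross (1a + 2), dihedral / vertex-chart changes (2)}; word atoms are exactly the torus-balanced terminal objects. -/
theorem stub_balancedRewriting : ∀ (k : ℕ) (q : ℚ) (a : Fin k → ℕ) (e : Fin k → Fin k → ℤ) (s : Literature.NumberTheory.Transcendental.KZ.IntegralRep k), s.domain = {x : Fin k → ℝ | ∀ i, x i ∈ Set.Ioo (0:ℝ) 1} → Set.EqOn s.integrand (fun x => (q : ℝ) * ((∏ i : Fin k, x i ^ a i) * ∏ i : Fin k, ∏ j : Fin k, if i ≤ j then (1 - (∏ l : Fin k, if i ≤ l ∧ l ≤ j then x l else 1)) ^ e i j else 1)) s.domain → ¬ (∃ lam : Fin k → ℤ, (∀ l : Fin k, lam l = 0 ∨ lam l = 1 ∨ lam l = -1) ∧ (∃ p : Fin k, lam p = -1) ∧ (∀ i j : Fin k, i ≤ j → e i j ≠ 0 → (∑ l : Fin k, if i ≤ l ∧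 l ≤ j then lam l else 0) = 0) ∧ (∑ l : Fin k, lam l * ((a l : ℤ) + 1)) ≠ 0) → ∃ m ∈ AddSubgroup.closure ({z : Literature.NumberTheory.Transcendental.KZ.FormalRep | ∃ (q : ℚ) (ε : Fin k → Bool) (s : Literature.NumberTheory.Transcendental.KZ.IntegralRep k), s.domain = {x : Fin k → ℝ | ∀ i, x i ∈ Set.Ioo (0:ℝ) 1} ∧ Set.EqOn s.integrand (fun x => (q : ℝ) * ((∏ i : Fin k, x i ^ (k - 1 - (i : ℕ))) * ∏ i : Fin k, if ε i then 1 / (1 - (∏ l : Fin k, if l ≤ i then x l else 1)) else 1 / (∏ l : Fin k, if l ≤ i then x l else 1))) s.domain ∧ z = Literature.NumberTheory.Transcendental.KZ.of s} ∪ {z : Literature.NumberTheory.Transcendental.KZ.FormalRep | ∃ (q : ℚ) (a : Fin k → ℕ) (e : Fin k → Fin k → ℤ) (s : Literature.NumberTheory.Transcendental.KZ.IntegralRep k), (∃ lam : Fin k → ℤ, (∀ l : Fin k, lam l = 0 ∨ lam l = 1 ∨ lam l = -1) ∧ (∃ p : Fin k, lam p = -1) ∧ (∀ i j : Fin k, i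 ≤ j → e i j ≠ 0 → (∑ l : Fin k, if i ≤ l ∧ l ≤ j then lam l else 0) = 0) ∧ (∑ l : Fin k, lam l * ((a l : ℤ) + 1)) ≠ 0) ∧ s.domain = {x : Fin k → ℝ | ∀ i, x i ∈ Set.Ioo (0:ℝ) 1} ∧ Set.EqOn s.integrand (fun x => (q : ℝ) * ((∏ i : Fin k, x i ^ a i) * ∏ i : Fin k, ∏ j : Fin k, if i ≤ j then (1 - (∏ l : Fin k, if i ≤ l ∧ l ≤ j then x l else 1)) ^ e i j else 1)) s.domain ∧ z = Literature.NumberTheory.Transcendental.KZ.of s} ∪ {z : Literature.NumberTheory.Transcendental.KZ.FormalRep | ∃ d : ℕ, d < k ∧ z ∈ {z : Literature.NumberTheory.Transcendental.KZ.FormalRep | ∃ (q : ℚ) (a : Fin d → ℕ) (e : Fin d → Fin d → ℤ) (s : Literature.NumberTheory.Transcendental.KZ.IntegralRep d), s.domain = {x : Fin d → ℝ | ∀ i, x i ∈ Set.Ioo (0:ℝ) 1} ∧ Set.EqOn s.integrand (fun x => (q : ℝ) * ((∏ i : Fin d, x i ^ a i) * ∏ i : Fin d, ∏ j : Fin d,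 if i ≤ j then (1 - (∏ l : Fin d, if i ≤ l ∧ l ≤ j then x l else 1)) ^ e i j else 1)) s.domain ∧ z = Literature.NumberTheory.Transcendental.KZ.of s}}), Literature.NumberTheory.Transcendental.KZ.of s - m ∈ Literature.NumberTheory.Transcendental.KZ.relations := by
  sorry

/-- **stub_wordAtomChart** (M). EXIT: the inverse cubical chart `x ↦ t`, `tᵢ = x₀⋯xᵢ` (rule 2: polynomial, injective on the open cube, Jacobian `∏ xᵢ^{k-1-i}`, image the open ordered simplex) identifies a word atom with the MZV word representation `[Δ_k, q·∏ ω_{εᵢ}(tᵢ)]` of the crux's target set. -/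
theorem stub_wordAtomChart : ∀ (k : ℕ) (q : ℚ) (ε : Fin k → Bool) (s : Literature.NumberTheory.Transcendental.KZ.IntegralRep k), s.domain = {x : Fin k → ℝ | ∀ i, x i ∈ Set.Ioo (0:ℝ) 1} → Set.EqOn s.integrand (fun x => (q : ℝ) * ((∏ i : Fin k, x i ^ (k - 1 - (i : ℕ))) * ∏ i : Fin k, if ε i then 1 / (1 - (∏ l : Fin k, if l ≤ i then x l else 1)) else 1 / (∏ l : Fin k, if l ≤ i then x l else 1))) s.domain → ∃ m ∈ AddSubgroup.closure {x : Literature.NumberTheory.Transcendental.KZ.FormalRep | ∃ (w : ℕ) (ε : Fin w → Bool) (q : ℚ) (s : Literature.NumberTheory.Transcendental.KZ.IntegralRep w), s.domain = {t | (∀ i, 0 < t i) ∧ (∀ i, t i < 1) ∧ StrictAnti t} ∧ Set.EqOn s.integrand (fun t => (q : ℝ) * ∏ i, if ε i then 1 / (1 - t i) else 1 / t i) s.domain ∧ x = Literature.NumberTheory.Transcendental.KZ.of s}, Literature.NumberTheory.Transcendental.KZ.of s - m ∈ Literature.NumberTheory.Transcendental.KZ.relations := by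
  sorry

/-! ## Composition (sorry-free) -/

/-- Generator-wise reduction modulo `KZ.relations`: every element of `S` is congruent to a
`ℤ`-combination of elements of `T`. -/
def Red (S T : Set KZ.FormalRep) : Prop :=
  ∀ x ∈ S, ∃ c ∈ AddSubgroup.closure T, x - c ∈ KZ.relations

/-- Additive extension of a generator-wise reduction to the generated subgroup. -/
theorem closure_transfer {S T : Set KZ.FormalRep} (h : Red S T) :
    ∀ x ∈ AddSubgroup.closure S, ∃ c ∈ AddSubgroup.closure T, x - c ∈ KZ.relations := by
  intro x hx
  induction hx using AddSubgroup.closure_induction with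
  | mem x hx => exact h x hx
  | zero => exact ⟨0, zero_mem _, by simp⟩
  | add x y _ _ ihx ihy =>
    obtain ⟨m₁, hm₁, h₁⟩ := ihx
    obtain ⟨m₂, hm₂, h₂⟩ := ihy
    refine ⟨m₁ + m₂, add_mem hm₁ hm₂, ?_⟩
    have key := add_mem h₁ h₂
    rwa [show x - m₁ + (y - m₂) = x + y - (m₁ + m₂) by abel] at key
  | neg x _ ih =>
    obtain ⟨m, hm, h⟩ := ih
    refine ⟨-m, neg_mem hm, ?_⟩
    have key := neg_mem h
    rwa [show -(x - m) = -x - -m by abel] at key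

/-- Reductions glue along unions of sources. -/
theorem Red.union {S T U : Set KZ.FormalRep} (h₁ : Red S U) (h₂ : Red T U) : Red (S ∪ T) U := by
  rintro x (hx | hx)
  · exact h₁ x hx
  · exact h₂ x hx

/-- One congruence step: if `x - y ∈ relations` and `y` reduces, so does `x`. -/
theorem red_of_sub_mem {T : Set KZ.FormalRep} {x y : KZ.FormalRep} (hxy : x - y ∈ KZ.relations)
    (hy : ∃ c ∈ AddSubgroup.closure T, y - c ∈ KZ.relations) :
    ∃ c ∈ AddSubgroup.closure T, x - c ∈ KZ.relations := by
  obtain ⟨c, hc, hyc⟩ := hy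
  refine ⟨c, hc, ?_⟩
  have key := add_mem hxy hyc
  rwa [sub_add_sub_cancel] at key

/-- EXIT: word atoms reduce to the crux's word representations (`stub_wordAtomChart`). -/
theorem wAtom_red (k : ℕ) : Red (WAtom k) WordRep := by
  rintro z ⟨q, ε, s, hdom, hint, rfl⟩
  exact stub_wordAtomChart k q ε s hdom hint

/-- Simply-directed atoms of dimension `k` reduce to words, given the induction hypothesis in
all dimensions `< k` (`stub_torusDescent` + `stub_rebase`). -/
theorem sdAtom_red (k : ℕ) (IH : ∀ d < k, Red (Atom d) WordRep) : Red (SDAtom k) WordRep := by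
  rintro z ⟨q, a, e, s, ⟨lam, hlam, hp, hch, hE⟩, hdom, hint, rfl⟩
  cases k with
  | zero =>
    obtain ⟨p, -⟩ := hp
    exact p.elim0
  | succ k =>
    obtain ⟨B, hB, hrel⟩ := stub_torusDescent k q a e lam s hdom hint hlam hp hch hE
    obtain ⟨m, hm, hBm⟩ := stub_rebase k (q / (((∑ l : Fin (k + 1), lam l * ((a l : ℤ) + 1)) : ℤ) : ℚ)) a e lam B hlam hp hch hE hB
    have hLE : Red (AtomLE k) WordRep := by
      rintro x ⟨d, hd, hx⟩
      exact IH d (Nat.lt_succ_of_le hd) x hx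
    exact red_of_sub_mem hrel (red_of_sub_mem hBm (closure_transfer hLE m hm))

/-- Atoms of dimension `< k` reduce, given the induction hypothesis. -/
theorem atomLT_red (k : ℕ) (IH : ∀ d < k, Red (Atom d) WordRep) : Red (AtomLT k) WordRep := by
  rintro x ⟨d, hd, hx⟩
  exact IH d hd x hx

/-- Directed atoms of dimension `k` reduce to words, given the induction hypothesis
(`stub_nonSimpleReduction` on top of `sdAtom_red`). -/
theorem dAtom_red (k : ℕ) (IH : ∀ d < k, Red (Atom d) WordRep) : Red (DAtom k) WordRep := by
  rintro z ⟨q, a, e, s, hdir, hdom, hint, rfl⟩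
  by_cases hs : ∃ lam : Fin k → ℤ, (∀ l : Fin k, lam l = 0 ∨ lam l = 1 ∨ lam l = -1) ∧ (∃ p : Fin k, lam p = -1) ∧ (∀ i j : Fin k, i ≤ j → e i j ≠ 0 → (∑ l : Fin k, if i ≤ l ∧ l ≤ j then lam l else 0) = 0 ∧ (Finset.univ.filter (fun l : Fin k => i ≤ l ∧ l ≤ j ∧ lam l = 1)).card ≤ 1) ∧ (∑ l : Fin k, lam l * ((a l : ℤ) + 1)) ≠ 0
  · exact sdAtom_red k IH _ ⟨q, a, e, s, hs, hdom, hint, rfl⟩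
  · obtain ⟨m, hm, hsm⟩ := stub_nonSimpleReduction k q a e s hdom hint hs hdir
    have h3 : Red (SDAtom k ∪ WAtom k ∪ AtomLT k) WordRep :=
      ((sdAtom_red k IH).union (wAtom_red k)).union (atomLT_red k IH)
    exact red_of_sub_mem hsm (closure_transfer h3 m hm)

/-- Every atom reduces to words: strong induction on the dimension; balanced atoms are
rewritten first (`stub_balancedRewriting`). -/
theorem atom_red : ∀ k : ℕ, Red (Atom k) WordRep := by
  intro k
  induction k using Nat.strong_induction_on with
  | _ k IH =>
    rintro z ⟨q, a, e, s, hdom, hint, rfl⟩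
    by_cases hd : ∃ lam : Fin k → ℤ, (∀ l : Fin k, lam l = 0 ∨ lam l = 1 ∨ lam l = -1) ∧ (∃ p : Fin k, lam p = -1) ∧ (∀ i j : Fin k, i ≤ j → e i j ≠ 0 → (∑ l : Fin k, if i ≤ l ∧ l ≤ j then lam l else 0) = 0) ∧ (∑ l : Fin k, lam l * ((a l : ℤ) + 1)) ≠ 0
    · exact dAtom_red k IH _ ⟨q, a, e, s, hd, hdom, hint, rfl⟩
    · obtain ⟨m, hm, hsm⟩ := stub_balancedRewriting k q a e s hdom hint hd
      have h3 : Red (WAtom k ∪ DAtom k ∪ AtomLT k) WordRep :=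
        ((wAtom_red k).union (dAtom_red k IH)).union (atomLT_red k IH)
      exact red_of_sub_mem hsm (closure_transfer h3 m hm)

/-- **The crux, from the six stubs.** `LinRedNormalForm.DihedralNormalForm` BY NAME: reduce the
genus-zero input to atoms (`stub_atomReduction`), then every atom to words (`atom_red`);
`WordRep` is verbatim the crux's generator set. -/
theorem DihedralNormalForm_of :
    Summit.KontsevichZagierPeriods.KontsevichZagierPeriods.Theses.LinRedNormalForm.DihedralNormalForm := by
  intro k r p a b c hdom hint
  obtain ⟨m, hm, hrm⟩ := stub_atomReduction k r p a b c hdom hint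
  exact red_of_sub_mem hrm (closure_transfer (atom_red k) m hm)

end Summit.KontsevichZagierPeriods.KontsevichZagierPeriods.Cruxes.DihedralNormalForm.TorusDescent
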